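import Summits.AtomisticToContinuum.Crystallization.Theorems.FreeSplittingCertificatesRadiusLadderPeriodicQuotient
import Summits.AtomisticToContinuum.Crystallization.Theorems.FreeSplittingCertificatesRadiusLadderKeyGluing

/-!
# `FiniteRangeSplitting` (stmt-AtomisticToContinuum-12559): coset-readable fragments of attractive periodic configurations never refute

Companion of `FreeSplittingCertificatesRadiusLadder` (block-2b unit `b2b-freesplit-A`, gen 9).  VALUE = a theorem retiring an
infinite FAMILY of candidate refuters of the radius ladder (RESULTS-R2 §6 P3, any motif) — NOT summit progress; nothing
here closes an item.

From the quotient splitting `exists_cosetSplitting` of `…RadiusLadderPeriodicQuotient` (coset-pair weights `θ` with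
`e_∞ ≤ Σ_{y'} θ_{yy'} s_y(y')` at every coset of ANY periodic configuration `P = F + G` of `ℝ³`):

* for a finite injective fragment `x ⊆ F + G` of an ATTRACTIVE `P` (all realised pair energies `≤ 0`, e.g. all
  distances `≥ 2^{-1/6}`) with coset labels `κ`, the bond weights `θ_{κ(i)κ(j)}` are feasible row by row
  (`row_ge_of_cosetSplitting`: dropping the non-positive tail terms only increases each fibre sum, `fiber_bound`;
  translation invariance `cosetSum_add`);
* they glue into ONE genuine rule `Φ(v,T)` as soon as the realised keys of the zoo are COSET-READABLE — two ordered bonds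
  with the same key `(x_j - x_i, T_ij(R))` have their sources in the same coset of `G` (`exists_rule_of_keyConsistent`,
  the key-consistent generalisation of the recurrence-free gluing of `…RadiusLadderRecurrence`; automatic for Bravais
  lattices, `cosetReadable_of_bravais`; a finite check on any given zoo);
* `exists_feasibleOn_of_cosetReadable`, `not_refuting_of_cosetReadable_fragments`: such a zoo (any number of fragments of
  one attractive periodic configuration, any shapes, any radius `R`) is never in the hypothesis shape of
  `not_rungAt_of_zoo`.

So the "non-homogeneous periodic competitor" family of RESULTS-R2 §2 (A15 / Frank–Kasper / polytype balls at lattice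
constants with all distances `≥ 2^{-1/6}`) is dead as a stand-alone refuter of every rung before any LP is run, up to the
finite coset-readability check of its realised keys.
-/

noncomputable section
namespace Summit.AtomisticToContinuum.Crystallization.Theorems.StrictSplittingRuleBirth

open scoped BigOperators Classical
open Literature.MathematicalPhysics.StatisticalMechanics

/-- Euclidean `3`-space. -/
local notation "E3" => EuclideanSpace ℝ (Fin 3)

variable (P : PeriodicConfiguration 3)

/-! ## Gluing key-consistent bond weights into a rule -/

/-- **Key-consistent bond weights glue into a rule.**  Bond weights `W` on the ordered bonds of a zoo that are boxed,
complementary under reversal and CONSTANT ON REALISED KEYS (`zkey R b = zkey R b' → W b = W b'`) are the values of one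
genuine rule `Φ` (box + complementarity everywhere, `1/2` off the realised keys), whose site energies on the zoo are the
`W`-weighted pair sums.  (The recurrence-free gluing of `exists_feasibleOn_of_recurrenceFree` is the case of injective
keys.) [folklore] -/
theorem exists_rule_of_keyConsistent (R : ℝ) (Z : Finset Conf) (W : Bond → ℝ)
    (hbox : ∀ b ∈ zbonds Z, 0 ≤ W b ∧ W b ≤ 1) (hrev : ∀ b ∈ zbonds Z, W b + W b.rev = 1)
    (hcons : ∀ b ∈ zbonds Z, ∀ b' ∈ zbonds Z, zkey R b = zkey R b' → W b = W b') :
    ∃ Φ : E3 → Finset E3 → ℝ, IsRule Φ ∧ ∀ c ∈ Z, ∀ i : Fin c.1,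
      siteE R Φ c.2 i = ∑ j ∈ Finset.univ.erase i, W ⟨c, (i, j)⟩ * lennardJones (dist (c.2 i) (c.2 j)) := by
  classical
  let Ψ : Key → ℝ := fun k => if h : ∃ b ∈ zbonds Z, zkey R b = k then W (Classical.choose h) else 1 / 2
  have hΨkey : ∀ b ∈ zbonds Z, Ψ (zkey R b) = W b := by
    intro b hb
    have h : ∃ b' ∈ zbonds Z, zkey R b' = zkey R b := ⟨b, hb, rfl⟩
    simp only [Ψ, dif_pos h]
    obtain ⟨hb', hk⟩ := Classical.choose_spec h
    exact hcons _ hb' _ hb hk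
  have hΨfree : ∀ k : Key, (¬ ∃ b ∈ zbonds Z, zkey R b = k) → Ψ k = 1 / 2 := fun k hk => by
    simp only [Ψ, dif_neg hk]
  have hΨbox : ∀ k : Key, 0 ≤ Ψ k ∧ Ψ k ≤ 1 := by
    intro k
    by_cases h : ∃ b ∈ zbonds Z, zkey R b = k
    · obtain ⟨b, hb, rfl⟩ := h
      rw [hΨkey b hb]
      exact hbox b hb
    · rw [hΨfree k h]
      norm_num
  have hΨconj : ∀ k : Key, Ψ k + Ψ k.conj = 1 := by
    intro k
    by_cases h : ∃ b ∈ zbonds Z, zkey R b = k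
    · obtain ⟨b, hb, rfl⟩ := h
      rw [← zkey_rev, hΨkey b hb, hΨkey b.rev (rev_mem_zbonds hb)]
      exact hrev b hb
    · have h' : ¬ ∃ b ∈ zbonds Z, zkey R b = k.conj := by
        rintro ⟨b, hb, hk⟩
        refine h ⟨b.rev, rev_mem_zbonds hb, ?_⟩
        rw [zkey_rev, hk, Key.conj_conj]
      rw [hΨfree k h, hΨfree _ h']
      norm_num
  refine ⟨fun v T => Ψ (v, T), ⟨fun v T => hΨbox (v, T), fun v T _ => hΨconj (v, T)⟩, ?_⟩
  intro c hc i
  rw [perturbative_siteE_eq]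
  refine Finset.sum_congr rfl fun j hj => ?_
  have hij : i ≠ j := (Finset.ne_of_mem_erase hj).symm
  have hb : (⟨c, (i, j)⟩ : Bond) ∈ zbonds Z := mem_zbonds.2 ⟨hc, hij⟩
  have hk := hΨkey _ hb
  simp only [zkey] at hk
  rw [hk]

/-! ## Finite fragments of an attractive periodic configuration -/

/-- **Dropping the attractive tail, fibre by fibre**: for an injective fragment `x ⊆ F + G` of an ATTRACTIVE `P`
with coset labels `κ`, the coset pair sum `s_{x i}(y')` is at most the finite pair sum over the fragment sites
`j ≠ i` of coset `y'` (the omitted terms are `≤ 0`, the sum converges absolutely). -/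
theorem fiber_bound (hV : ∀ z ∈ P.points, ∀ z' ∈ P.points, z ≠ z' → lennardJones (dist z z') ≤ 0)
    {N : ℕ} {x : Fin N → E3} (hx : Function.Injective x) (hxP : ∀ i, x i ∈ P.points)
    (κ : Fin N → E3) (hκ : ∀ i, κ i ∈ P.motif ∧ x i ∈ coset P (κ i)) (i : Fin N) {y' : E3}
    (hy' : y' ∈ P.motif) :
    cosetSum P (x i) y' ≤
      ∑ j ∈ (Finset.univ.erase i).filter (fun j => κ j = y'), lennardJones (dist (x i) (x j)) := by
  set s := (Finset.univ.erase i).filter (fun j => κ j = y') with hs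
  set f : {z : E3 // z ∈ coset P y' ∧ z ≠ x i} → ℝ := fun z => lennardJones (dist (x i) z.1) with hf
  have hsum : Summable f := summable_cosetSum P hy' (x i)
  have hnp : ∀ z, f z ≤ 0 := fun z =>
    hV _ (hxP i) _ (coset_subset_points P hy' z.2.1) (Ne.symm z.2.2)
  have hmem : ∀ j ∈ s, x j ∈ coset P y' ∧ x j ≠ x i := by
    intro j hj
    rw [hs, Finset.mem_filter] at hj
    refine ⟨?_, hx.ne (Finset.ne_of_mem_erase hj.1)⟩
    rw [← hj.2]
    exact (hκ j).2
  let emb : {j // j ∈ s} ↪ {z : E3 // z ∈ coset P y' ∧ z ≠ x i} :=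
    ⟨fun j => ⟨x j.1, hmem j.1 j.2⟩, fun j j' h =>
      Subtype.ext (hx (congrArg (fun z : {z : E3 // z ∈ coset P y' ∧ z ≠ x i} => z.1) h))⟩
  have hfin : ∑ z ∈ s.attach.map emb, f z = ∑ j ∈ s, lennardJones (dist (x i) (x j)) := by
    rw [Finset.sum_map]
    exact Finset.sum_attach s fun j => lennardJones (dist (x i) (x j))
  have hle : ∑ z ∈ s.attach.map emb, (-f z) ≤ ∑' z, (-f z) :=
    Summable.sum_le_tsum _ (fun z _ => neg_nonneg.2 (hnp z)) hsum.neg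
  rw [Finset.sum_neg_distrib, tsum_neg, hfin] at hle
  show ∑' z, f z ≤ _
  linarith

/-- **Fragment rows dominate quotient rows.**  With coset-pair weights `θ ≥ 0` feasible on the quotient
(`e_∞ ≤ Σ_{y'} θ_{yy'} s_y(y')` at every coset) and an injective fragment `x ⊆ F + G` of an attractive `P` with coset
labels `κ`, every site row of the bond weights `θ_{κ(i)κ(j)}` is feasible:
`e_∞ ≤ Σ_{j ≠ i} θ_{κ(i)κ(j)} V_LJ(r_ij)` (fibrewise `fiber_bound`, translation invariance `cosetSum_add`). -/
theorem row_ge_of_cosetSplitting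
    (hV : ∀ z ∈ P.points, ∀ z' ∈ P.points, z ≠ z' → lennardJones (dist z z') ≤ 0)
    {θ : E3 → E3 → ℝ} (hθ0 : ∀ y y', 0 ≤ θ y y')
    (hθrow : ∀ y ∈ P.motif, eInf ≤ ∑ y' ∈ P.motif, θ y y' * cosetSum P y y')
    {N : ℕ} {x : Fin N → E3} (hx : Function.Injective x) (hxP : ∀ i, x i ∈ P.points)
    (κ : Fin N → E3) (hκ : ∀ i, κ i ∈ P.motif ∧ x i ∈ coset P (κ i)) (i : Fin N) :
    eInf ≤ ∑ j ∈ Finset.univ.erase i, θ (κ i) (κ j) * lennardJones (dist (x i) (x j)) := by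
  have hmaps : ∀ j ∈ Finset.univ.erase i, κ j ∈ P.motif := fun j _ => (hκ j).1
  rw [← Finset.sum_fiberwise_of_maps_to hmaps]
  have hstep : ∀ y' ∈ P.motif, θ (κ i) y' * cosetSum P (x i) y' ≤
      ∑ j ∈ (Finset.univ.erase i).filter (fun j => κ j = y'),
        θ (κ i) (κ j) * lennardJones (dist (x i) (x j)) := by
    intro y' hy'
    have hin : ∀ j ∈ (Finset.univ.erase i).filter (fun j => κ j = y'),
        θ (κ i) (κ j) * lennardJones (dist (x i) (x j)) = θ (κ i) y' * lennardJones (dist (x i) (x j)) := by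
      intro j hj
      rw [(Finset.mem_filter.1 hj).2]
    rw [Finset.sum_congr rfl hin, ← Finset.mul_sum]
    exact mul_le_mul_of_nonneg_left (fiber_bound P hV hx hxP κ hκ i hy') (hθ0 _ _)
  have htrans : ∀ y', cosetSum P (x i) y' = cosetSum P (κ i) y' := by
    intro y'
    obtain ⟨g, hg, hxg⟩ := (hκ i).2
    rw [hxg, cosetSum_add P _ _ hg]
  calc eInf ≤ ∑ y' ∈ P.motif, θ (κ i) y' * cosetSum P (κ i) y' := hθrow _ (hκ i).1
    _ = ∑ y' ∈ P.motif, θ (κ i) y' * cosetSum P (x i) y' := by simp only [htrans]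
    _ ≤ _ := Finset.sum_le_sum hstep

/-! ## Coset-readable zoos of periodic fragments never refute -/

/-- **Periodic fragments with coset-readable keys never refute (any motif).**  Let `P = F + G` be an ATTRACTIVE
periodic configuration of `ℝ³` (all realised pair energies `≤ 0`, e.g. all distances `≥ 2^{-1/6}`) and `Z` a zoo
of injective fragments of `P` whose realised keys at radius `R` are COSET-READABLE: two ordered bonds of `Z` with
the same key `(x_j - x_i, T_ij(R))` have their sources in the same coset of `G`.  Then ONE rule is feasible at every
site of every configuration of `Z`: the quotient splitting `exists_cosetSplitting` read through the coset labels
(`row_ge_of_cosetSplitting`), glued by `exists_rule_of_keyConsistent`. -/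
theorem exists_feasibleOn_of_cosetReadable (R : ℝ) (Z : Finset Conf)
    (hV : ∀ z ∈ P.points, ∀ z' ∈ P.points, z ≠ z' → lennardJones (dist z z') ≤ 0)
    (hZ : ∀ c ∈ Z, Function.Injective c.2 ∧ ∀ i, c.2 i ∈ P.points)
    (hread : ∀ b ∈ zbonds Z, ∀ b' ∈ zbonds Z, zkey R b = zkey R b' →
      b.1.2 b.2.1 - b'.1.2 b'.2.1 ∈ P.lattice) :
    ∃ Φ : E3 → Finset E3 → ℝ, IsRule Φ ∧ ∀ c ∈ Z, ∀ i : Fin c.1, eInf ≤ siteE R Φ c.2 i := by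
  classical
  obtain ⟨θ, hθ0, hθ1, hθrow⟩ := exists_cosetSplitting P
  -- coset labels of the sites of the zoo (junk outside `Z`)
  have hrep : ∀ (c : Conf) (i : Fin c.1), ∃ y : E3, c ∈ Z → y ∈ P.motif ∧ c.2 i ∈ coset P y := by
    intro c i
    by_cases hc : c ∈ Z
    · obtain ⟨y, hy, hyc⟩ := (mem_points_iff P).1 ((hZ c hc).2 i)
      exact ⟨y, fun _ => ⟨hy, hyc⟩⟩
    · exact ⟨0, fun h => absurd h hc⟩
  choose κ hκ using hrep
  -- bond weights read off the quotient splitting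
  let W : Bond → ℝ := fun b => θ (κ b.1 b.2.1) (κ b.1 b.2.2)
  have hbox : ∀ b ∈ zbonds Z, 0 ≤ W b ∧ W b ≤ 1 := by
    intro b _
    have h1 := hθ1 (κ b.1 b.2.1) (κ b.1 b.2.2)
    have h2 := hθ0 (κ b.1 b.2.2) (κ b.1 b.2.1)
    exact ⟨hθ0 _ _, by simp only [W]; linarith⟩
  have hrev : ∀ b ∈ zbonds Z, W b + W b.rev = 1 := fun b _ => hθ1 _ _
  have hcons : ∀ b ∈ zbonds Z, ∀ b' ∈ zbonds Z, zkey R b = zkey R b' → W b = W b' := by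
    intro b hb b' hb' hk
    have hc := (mem_zbonds.1 hb).1
    have hc' := (mem_zbonds.1 hb').1
    have hsrc : b.1.2 b.2.1 - b'.1.2 b'.2.1 ∈ P.lattice := hread b hb b' hb' hk
    have hvec : b.1.2 b.2.2 - b.1.2 b.2.1 = b'.1.2 b'.2.2 - b'.1.2 b'.2.1 := congrArg Prod.fst hk
    have hdst : b.1.2 b.2.2 - b'.1.2 b'.2.2 ∈ P.lattice := by
      rw [sub_eq_sub_iff_sub_eq_sub.1 hvec]
      exact hsrc
    have h1 : κ b.1 b.2.1 = κ b'.1 b'.2.1 :=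
      rep_eq P (hκ _ _ hc).1 (hκ _ _ hc').1 (hκ _ _ hc).2 (hκ _ _ hc').2 hsrc
    have h2 : κ b.1 b.2.2 = κ b'.1 b'.2.2 :=
      rep_eq P (hκ _ _ hc).1 (hκ _ _ hc').1 (hκ _ _ hc).2 (hκ _ _ hc').2 hdst
    simp only [W, h1, h2]
  obtain ⟨Φ, hΦ, hsite⟩ := exists_rule_of_keyConsistent R Z W hbox hrev hcons
  refine ⟨Φ, hΦ, fun c hc i => ?_⟩
  rw [hsite c hc i]
  exact row_ge_of_cosetSplitting P hV hθ0 hθrow (hZ c hc).1 (hZ c hc).2 (κ c) (fun j => hκ c j hc) i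

/-- **In a Bravais lattice every zoo is coset-readable** (one coset): the hypothesis of
`exists_feasibleOn_of_cosetReadable` is automatic when `#F = 1`. -/
theorem cosetReadable_of_bravais (hP : P.motif.card = 1) (R : ℝ) (Z : Finset Conf)
    (hZ : ∀ c ∈ Z, ∀ i, c.2 i ∈ P.points) :
    ∀ b ∈ zbonds Z, ∀ b' ∈ zbonds Z, zkey R b = zkey R b' → b.1.2 b.2.1 - b'.1.2 b'.2.1 ∈ P.lattice := by
  intro b hb b' hb' _
  obtain ⟨y₀, hy₀⟩ := Finset.card_eq_one.1 hP
  have key : ∀ z ∈ P.points, z - y₀ ∈ P.lattice := by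
    intro z hz
    obtain ⟨y, hy, hzy⟩ := P.exists_sub_mem_lattice hz
    rw [hy₀, Finset.mem_singleton] at hy
    rw [← hy]
    exact hzy
  have h1 := key _ (hZ _ (mem_zbonds.1 hb).1 b.2.1)
  have h2 := key _ (hZ _ (mem_zbonds.1 hb').1 b'.2.1)
  have : b.1.2 b.2.1 - b'.1.2 b'.2.1 = (b.1.2 b.2.1 - y₀) - (b'.1.2 b'.2.1 - y₀) := by abel
  rw [this]
  exact P.lattice.sub_mem h1 h2

/-- **Coset-readable periodic fragments plus key-disjoint recurrence-free defects never refute** (the analogue of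
`exists_feasibleOn_periodic_union_recurrenceFree` for an arbitrary motif): the glued quotient rule on the periodic keys,
glued free pair splittings on the defects. -/
theorem exists_feasibleOn_cosetReadable_union_recurrenceFree (R : ℝ) {Zp Zd : Finset Conf}
    (hV : ∀ z ∈ P.points, ∀ z' ∈ P.points, z ≠ z' → lennardJones (dist z z') ≤ 0)
    (hZ : ∀ c ∈ Zp, Function.Injective c.2 ∧ ∀ i, c.2 i ∈ P.points)
    (hread : ∀ b ∈ zbonds Zp, ∀ b' ∈ zbonds Zp, zkey R b = zkey R b' →
      b.1.2 b.2.1 - b'.1.2 b'.2.1 ∈ P.lattice)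
    (hd : ∀ c ∈ Zd, Function.Injective c.2) (hfree : RecurrenceFree R Zd)
    (hdis : Disjoint (zkeys R Zp) (zkeys R Zd)) :
    ∃ Φ : E3 → Finset E3 → ℝ, IsRule Φ ∧ ∀ c ∈ Zp ∪ Zd, ∀ i : Fin c.1, eInf ≤ siteE R Φ c.2 i := by
  obtain ⟨Φ₁, hΦ₁, h₁⟩ := exists_feasibleOn_of_cosetReadable P R Zp hV hZ hread
  exact exists_feasibleOn_union_recurrenceFree R hΦ₁ h₁ hd hfree hdis

/-- **A coset-readable zoo of attractive periodic fragments is never refuting**: it is never in the hypothesis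
shape of `not_rungAt_of_zoo`, at any radius `R` — whatever the motif of the periodic configuration. -/
theorem not_refuting_of_cosetReadable_fragments (R : ℝ) (Z : Finset Conf)
    (hV : ∀ z ∈ P.points, ∀ z' ∈ P.points, z ≠ z' → lennardJones (dist z z') ≤ 0)
    (hZ : ∀ c ∈ Z, Function.Injective c.2 ∧ ∀ i, c.2 i ∈ P.points)
    (hread : ∀ b ∈ zbonds Z, ∀ b' ∈ zbonds Z, zkey R b = zkey R b' →
      b.1.2 b.2.1 - b'.1.2 b'.2.1 ∈ P.lattice) :
    ¬ ∀ Φ : E3 → Finset E3 → ℝ, IsRule Φ → ∃ c ∈ Z, ∃ i : Fin c.1, siteE R Φ c.2 i < eInf := by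
  intro href
  obtain ⟨Φ, hr, hf⟩ := exists_feasibleOn_of_cosetReadable P R Z hV hZ hread
  obtain ⟨c, hc, i, hlt⟩ := href Φ hr
  exact (not_lt.2 (hf c hc i)) hlt

end Summit.AtomisticToContinuum.Crystallization.Theorems.StrictSplittingRuleBirth

end
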